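import Literature.AlgebraicGeometry.Motives.AbelianVarietyWeilPairingPullback
import Literature.AlgebraicGeometry.Motives.AbelianVarietyWeilPairingAlternating
import Literature.AlgebraicGeometry.Motives.AbelianVarietyWeilPairingBiprod
import Literature.AlgebraicGeometry.Motives.AbelianVarietyTangentKillers
import HarnessLib

/-!
# The calculus of LEVEL ADJOINTS for the Weil pairings `ē_N^Θ`: composites, sums, scalars, identities, isomorphisms, reversal

Layer `Literature/AlgebraicGeometry/Motives`, namespace `Literature.AlgebraicGeometry.Motives.AbelianVariety`.  THEOREMS ONLY
(no definition, no named fact, no instance, no `sorry`).  Cell `hodgecm-mathlib` (D-0151), fan A, count-neutral capital: the glue the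
d6 slot `slot_levelAdjoint` (A-plan2 (g12) 2026-08-30T04:26:57Z, `RosHShape` road (P)/(A)) needs to assemble the level adjoint of a
PUSH–PULL WORD (★ (P3) `heckeEnd_eq_pushPull_of_aut`: `t ≫ Σ_γ Alb(T_γ)`) from the adjoints of its LETTERS — (F-P2) ★
`Jacobian.galoisCover_pullback_isWeilPairingAdjoint_norm` («`p^*` is the `ē_N`-adjoint of `Nm_p`») and Q1 ★ `JacobianGaloisCoverNorm` give the
letters; this file gives words.  HC_CM is proved only modulo the 7 printed citations until rung 0 closes; nothing here is specific to it.

TERMINOLOGY (no definition is introduced; every statement spells the clause out).  For homomorphisms `x : A → B`, `x† : B → A` of abelian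
varieties over a field `K`, divisors `Θ_A`, `Θ_B`, and `d ∈ ℕ`, «`(x, x†)` is a LEVEL ADJOINT PAIR of weight `d` for `(Θ_A, Θ_B)`» means
`ē_N^{Θ_B}((d·x) P, Q) = ē_N^{Θ_A}(P, x† Q)` for every level `N` (at which `[N]_A`, `[N]_B` are dominant, the binder needed to FORM the tree's
`weilPairingLevel`) and all `P ∈ A[N](K)`, `Q ∈ B[N](K)` — the shape of Mumford §20 property (3) «`e_n(f(x), ŷ) = e_n(x, f̂(ŷ))`» and of
★ `weilPairingLevel_map_rosatiDual`, ★ (C1) `exists_isPositiveAntiInvolution_adjoin_of_levelAdjoint`, ★ (F-P2).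

* §0 points of composites / sums / multiples as torsion points (`torsionPoints_map_comp`, `_add`, `_natCast_zsmul`, `_zero`, `_sum`, `_id`).
* §1 **`levelAdjoint_comp`** (weights multiply, adjoints compose in reverse), **`levelAdjoint_add`**, `levelAdjoint_zero`, **`levelAdjoint_sum`**,
  `levelAdjoint_nsmul` (both sides), `levelAdjoint_weight_mul` (raise the weight: `(x, m·x†)` has weight `m·d`), `levelAdjoint_id`.
* §2 **`levelAdjoint_iso_pullback`** — an isomorphism `φ : A ≅ B` with `Θ_A = φ^* Θ_B` is adjoint to its inverse (weight 1; ★ `weilPairingLevel_pullback`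
  «`ē^{f^*Θ}(P, Q) = ē^Θ(fP, fQ)`», Mumford §20 (3)).
* §3 **`levelAdjoint_reverse`** — skew-symmetry (★ `weilPairingLevel_swap`, Lang VII §2 Thm. 5 (i)) turns `(x, x†)` of weight `d` for
  `(Θ_A, Θ_B)` into `(x†, d·x)` of weight `1` for `(Θ_B, Θ_A)`: `ē_N^{Θ_A}((1·x†) Q, P) = ē_N^{Θ_B}(Q, (d·x) P)`, on DIVISIBLE point groups
  (`R ↦ R^N` onto, e.g. `K` algebraically closed of characteristic prime to `N`); with (F-P2) this gives the `Nm_p`-letters from the `p^*`-letters.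
* §4 **`levelAdjoint_fan_entry`** — for `Y` presented as a biproduct `⊞_c J_c` (fan `π, ι`) with PRODUCT level pairings `ē^Θ = ∏_c ē^{W_c} ∘ π_c`
  (hypothesis), a matrix entry `π_c ≫ f ≫ ι_{c′}` has the adjoint `π_{c′} ≫ f† ≫ ι_c` whenever `(f, f†)` is a level adjoint pair for
  `(W_c, W_{c′})` — the transposed matrix of adjoints (Mumford §20: orthogonal sum of Riemann forms).

## References
* [MumfordAV1970] D. Mumford, *Abelian Varieties* (1970), §20, property (3) of `e_n` (p. 186) and §21 (the Rosati involution).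
* [Lang1983AbelianVarieties] S. Lang, *Abelian Varieties* (1983), Ch. VII §2 Prop. 3 (bilinearity) and Thm. 5 (i) (alternation).
* Tree: ★ `Motives/AbelianVarietyWeilPairingLevel` (`weilPairingLevel`, `_mul_left/right`, `_pow_left/right`, `_one_left/right`),
  ★ `…WeilPairingPullback` (`map_mem_torsionPoints`, `weilPairingLevel_pullback`), ★ `…WeilPairingAlternating` (`weilPairingLevel_swap`),
  ★ `…WeilPairingBiprod` (`isDominant_toSchemeHom_of_comp_eq_id`), ★ `…TangentKillers` (`comp_hom_hom_hom_add/_sum/_comp/_zero`).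
-/

set_option autoImplicit false

universe u

open CategoryTheory CategoryTheory.Limits AlgebraicGeometry

noncomputable section

namespace Literature.AlgebraicGeometry.Motives

namespace AbelianVariety

variable {K : Type u} [Field K] {A B C : AbelianVariety K}

/-! ## §0 Images of torsion points under composites, sums and multiples -/

/-- `(x ≫ y) P = y (x P)` on rational points. [cite: MumfordAV1970, §19 (Hom(X,Y), first paragraph)] -/
theorem map_hom_comp_apply (x : A ⟶ B) (y : B ⟶ C) (P : A.Points K) :
    AlgPoints.map (x ≫ y).hom.hom.hom P = AlgPoints.map y.hom.hom.hom (AlgPoints.map x.hom.hom.hom P) := by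
  rw [AlgPoints.map_apply, AlgPoints.map_apply, AlgPoints.map_apply]
  exact comp_hom_hom_hom_comp P x y

/-- `(x + x') P = x P · x' P` on rational points (the group `B(K)` written multiplicatively). [cite: MumfordAV1970, §19 (Hom(X,Y), first paragraph)] -/
theorem map_hom_add_apply (x x' : A ⟶ B) (P : A.Points K) :
    AlgPoints.map (x + x').hom.hom.hom P = AlgPoints.map x.hom.hom.hom P * AlgPoints.map x'.hom.hom.hom P := by
  rw [AlgPoints.map_apply, AlgPoints.map_apply, AlgPoints.map_apply]
  exact comp_hom_hom_hom_add P x x'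

/-- `0 P = 1` on rational points. [cite: MumfordAV1970, §19 (Hom(X,Y), first paragraph)] -/
theorem map_hom_zero_apply (P : A.Points K) : AlgPoints.map (0 : A ⟶ B).hom.hom.hom P = 1 := by
  rw [AlgPoints.map_apply]
  exact comp_hom_hom_hom_zero P

/-- `(Σᵢ xᵢ) P = ∏ᵢ xᵢ P` on rational points. [cite: MumfordAV1970, §19 (Hom(X,Y), first paragraph)] -/
theorem map_hom_sum_apply {J : Type*} (s : Finset J) (x : J → (A ⟶ B)) (P : A.Points K) :
    AlgPoints.map (∑ j ∈ s, x j).hom.hom.hom P = ∏ j ∈ s, AlgPoints.map (x j).hom.hom.hom P := by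
  rw [AlgPoints.map_apply]
  exact comp_hom_hom_hom_sum P s x

/-- `((n : ℤ) • x) P = (x P)^n` on rational points. [cite: MumfordAV1970, §19 (Hom(X,Y), first paragraph)] -/
theorem map_hom_natCast_zsmul_apply (n : ℕ) (x : A ⟶ B) (P : A.Points K) :
    AlgPoints.map ((n : ℤ) • x).hom.hom.hom P = AlgPoints.map x.hom.hom.hom P ^ n := by
  rw [natCast_zsmul]
  induction n with
  | zero => rw [zero_nsmul, pow_zero, map_hom_zero_apply]
  | succ n ih => rw [succ_nsmul, map_hom_add_apply, ih, pow_succ]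

/-- Torsion-point form of `map_hom_comp_apply`. [cite: MumfordAV1970, §19 (Hom(X,Y), first paragraph)] -/
theorem torsionPoints_map_comp {N : ℤ} (x : A ⟶ B) (y : B ⟶ C) (P : A.torsionPoints K N) :
    (⟨AlgPoints.map (x ≫ y).hom.hom.hom P.1, map_mem_torsionPoints (x ≫ y) P.2⟩ : C.torsionPoints K N) =
      ⟨AlgPoints.map y.hom.hom.hom (AlgPoints.map x.hom.hom.hom P.1), map_mem_torsionPoints y (map_mem_torsionPoints x P.2)⟩ :=
  Subtype.ext (map_hom_comp_apply x y P.1)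

/-- Torsion-point form of `map_hom_add_apply`. [cite: MumfordAV1970, §19 (Hom(X,Y), first paragraph)] -/
theorem torsionPoints_map_add {N : ℤ} (x x' : A ⟶ B) (P : A.torsionPoints K N) :
    (⟨AlgPoints.map (x + x').hom.hom.hom P.1, map_mem_torsionPoints (x + x') P.2⟩ : B.torsionPoints K N) =
      ⟨AlgPoints.map x.hom.hom.hom P.1, map_mem_torsionPoints x P.2⟩ * ⟨AlgPoints.map x'.hom.hom.hom P.1, map_mem_torsionPoints x' P.2⟩ :=
  Subtype.ext (map_hom_add_apply x x' P.1)

/-- Torsion-point form of `map_hom_zero_apply`. [cite: MumfordAV1970, §19 (Hom(X,Y), first paragraph)] -/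
theorem torsionPoints_map_zero {N : ℤ} (P : A.torsionPoints K N) :
    (⟨AlgPoints.map (0 : A ⟶ B).hom.hom.hom P.1, map_mem_torsionPoints (0 : A ⟶ B) P.2⟩ : B.torsionPoints K N) = 1 :=
  Subtype.ext (map_hom_zero_apply P.1)

/-- Torsion-point form of `map_hom_natCast_zsmul_apply`. [cite: MumfordAV1970, §19 (Hom(X,Y), first paragraph)] -/
theorem torsionPoints_map_natCast_zsmul {N : ℤ} (n : ℕ) (x : A ⟶ B) (P : A.torsionPoints K N) :
    (⟨AlgPoints.map ((n : ℤ) • x).hom.hom.hom P.1, map_mem_torsionPoints ((n : ℤ) • x) P.2⟩ : B.torsionPoints K N) =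
      ⟨AlgPoints.map x.hom.hom.hom P.1, map_mem_torsionPoints x P.2⟩ ^ n :=
  Subtype.ext (map_hom_natCast_zsmul_apply n x P.1)

/-- Torsion-point form of `𝟙 P = P`. [cite: MumfordAV1970, §19 (Hom(X,Y), first paragraph)] -/
theorem torsionPoints_map_id {N : ℤ} (P : A.torsionPoints K N) :
    (⟨AlgPoints.map (𝟙 A : A ⟶ A).hom.hom.hom P.1, map_mem_torsionPoints (𝟙 A) P.2⟩ : A.torsionPoints K N) = P :=
  Subtype.ext (show AlgPoints.map (𝟙 A : A ⟶ A).hom.hom.hom P.1 = P.1 by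
    rw [AlgPoints.map_apply]; exact Category.comp_id _)

/-! ## §1 Composites, sums, multiples, the identity -/

/-- **Level adjoints COMPOSE (in reverse), weights MULTIPLY**: if `ē^{Θ_B}((d₁·x₁) P, Q) = ē^{Θ_A}(P, y₁ Q)` and
`ē^{Θ_C}((d₂·x₂) Q, R) = ē^{Θ_B}(Q, y₂ R)` at every level, then `ē^{Θ_C}((d₁d₂·(x₁ ≫ x₂)) P, R) = ē^{Θ_A}(P, (y₂ ≫ y₁) R)`
(Mumford §20 (3) for `f = x₁ x₂`, `f̂ = x̂₂ x̂₁`). [cite: MumfordAV1970, §20 (p. 186, property (3) of e_n) and §21] -/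
theorem levelAdjoint_comp (ΘA : CartierDivisor A.X.left) (ΘB : CartierDivisor B.X.left) (ΘC : CartierDivisor C.X.left)
    {x₁ : A ⟶ B} {y₁ : B ⟶ A} {d₁ : ℕ} {x₂ : B ⟶ C} {y₂ : C ⟶ B} {d₂ : ℕ}
    (h₁ : ∀ (N : ℕ) [IsDominant (Hom.toSchemeHom ((N : ℤ) • 𝟙 A))] [IsDominant (Hom.toSchemeHom ((N : ℤ) • 𝟙 B))]
      (P : A.torsionPoints K N) (Q : B.torsionPoints K N),
      B.weilPairingLevel ΘB ⟨AlgPoints.map ((d₁ : ℤ) • x₁).hom.hom.hom P.1, map_mem_torsionPoints ((d₁ : ℤ) • x₁) P.2⟩ Q =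
        A.weilPairingLevel ΘA P ⟨AlgPoints.map y₁.hom.hom.hom Q.1, map_mem_torsionPoints y₁ Q.2⟩)
    (h₂ : ∀ (N : ℕ) [IsDominant (Hom.toSchemeHom ((N : ℤ) • 𝟙 B))] [IsDominant (Hom.toSchemeHom ((N : ℤ) • 𝟙 C))]
      (Q : B.torsionPoints K N) (R : C.torsionPoints K N),
      C.weilPairingLevel ΘC ⟨AlgPoints.map ((d₂ : ℤ) • x₂).hom.hom.hom Q.1, map_mem_torsionPoints ((d₂ : ℤ) • x₂) Q.2⟩ R =
        B.weilPairingLevel ΘB Q ⟨AlgPoints.map y₂.hom.hom.hom R.1, map_mem_torsionPoints y₂ R.2⟩)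
    (N : ℕ) [IsDominant (Hom.toSchemeHom ((N : ℤ) • 𝟙 A))] [IsDominant (Hom.toSchemeHom ((N : ℤ) • 𝟙 B))]
    [IsDominant (Hom.toSchemeHom ((N : ℤ) • 𝟙 C))] (P : A.torsionPoints K N) (R : C.torsionPoints K N) :
    C.weilPairingLevel ΘC
        ⟨AlgPoints.map (((d₁ * d₂ : ℕ) : ℤ) • (x₁ ≫ x₂)).hom.hom.hom P.1, map_mem_torsionPoints (((d₁ * d₂ : ℕ) : ℤ) • (x₁ ≫ x₂)) P.2⟩ R =
      A.weilPairingLevel ΘA P ⟨AlgPoints.map (y₂ ≫ y₁).hom.hom.hom R.1, map_mem_torsionPoints (y₂ ≫ y₁) R.2⟩ := by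
  have e : ((d₁ * d₂ : ℕ) : ℤ) • (x₁ ≫ x₂) = ((d₁ : ℤ) • x₁) ≫ ((d₂ : ℤ) • x₂) := by
    rw [Preadditive.zsmul_comp, Preadditive.comp_zsmul, smul_smul, Nat.cast_mul, mul_comm]
  have eP : (⟨AlgPoints.map (((d₁ * d₂ : ℕ) : ℤ) • (x₁ ≫ x₂)).hom.hom.hom P.1,
        map_mem_torsionPoints (((d₁ * d₂ : ℕ) : ℤ) • (x₁ ≫ x₂)) P.2⟩ : C.torsionPoints K N) =
      ⟨AlgPoints.map ((d₂ : ℤ) • x₂).hom.hom.hom (AlgPoints.map ((d₁ : ℤ) • x₁).hom.hom.hom P.1),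
        map_mem_torsionPoints ((d₂ : ℤ) • x₂) (map_mem_torsionPoints ((d₁ : ℤ) • x₁) P.2)⟩ :=
    Subtype.ext (by rw [e]; exact map_hom_comp_apply _ _ P.1)
  rw [eP, h₂ N ⟨_, map_mem_torsionPoints ((d₁ : ℤ) • x₁) P.2⟩ R, h₁ N P ⟨_, map_mem_torsionPoints y₂ R.2⟩,
    torsionPoints_map_comp]

/-- **Level adjoints ADD** (same weight): `(x + x′, y + y′)` from `(x, y)` and `(x′, y′)` (Lang VII §2 Prop. 3: `ē` is bimultiplicative).
[cite: Lang1983AbelianVarieties, Ch. VII §2 Prop. 3] [cite: MumfordAV1970, §20 (p. 186, property (3) of e_n)] -/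
theorem levelAdjoint_add (ΘA : CartierDivisor A.X.left) (ΘB : CartierDivisor B.X.left)
    {x x' : A ⟶ B} {y y' : B ⟶ A} {d : ℕ}
    (h : ∀ (N : ℕ) [IsDominant (Hom.toSchemeHom ((N : ℤ) • 𝟙 A))] [IsDominant (Hom.toSchemeHom ((N : ℤ) • 𝟙 B))]
      (P : A.torsionPoints K N) (Q : B.torsionPoints K N),
      B.weilPairingLevel ΘB ⟨AlgPoints.map ((d : ℤ) • x).hom.hom.hom P.1, map_mem_torsionPoints ((d : ℤ) • x) P.2⟩ Q =
        A.weilPairingLevel ΘA P ⟨AlgPoints.map y.hom.hom.hom Q.1, map_mem_torsionPoints y Q.2⟩)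
    (h' : ∀ (N : ℕ) [IsDominant (Hom.toSchemeHom ((N : ℤ) • 𝟙 A))] [IsDominant (Hom.toSchemeHom ((N : ℤ) • 𝟙 B))]
      (P : A.torsionPoints K N) (Q : B.torsionPoints K N),
      B.weilPairingLevel ΘB ⟨AlgPoints.map ((d : ℤ) • x').hom.hom.hom P.1, map_mem_torsionPoints ((d : ℤ) • x') P.2⟩ Q =
        A.weilPairingLevel ΘA P ⟨AlgPoints.map y'.hom.hom.hom Q.1, map_mem_torsionPoints y' Q.2⟩)
    (N : ℕ) [IsDominant (Hom.toSchemeHom ((N : ℤ) • 𝟙 A))] [IsDominant (Hom.toSchemeHom ((N : ℤ) • 𝟙 B))]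
    (P : A.torsionPoints K N) (Q : B.torsionPoints K N) :
    B.weilPairingLevel ΘB ⟨AlgPoints.map ((d : ℤ) • (x + x')).hom.hom.hom P.1, map_mem_torsionPoints ((d : ℤ) • (x + x')) P.2⟩ Q =
      A.weilPairingLevel ΘA P ⟨AlgPoints.map (y + y').hom.hom.hom Q.1, map_mem_torsionPoints (y + y') Q.2⟩ := by
  have eP : (⟨AlgPoints.map ((d : ℤ) • (x + x')).hom.hom.hom P.1, map_mem_torsionPoints ((d : ℤ) • (x + x')) P.2⟩ :
        B.torsionPoints K N) =
      ⟨AlgPoints.map ((d : ℤ) • x).hom.hom.hom P.1, map_mem_torsionPoints ((d : ℤ) • x) P.2⟩ *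
        ⟨AlgPoints.map ((d : ℤ) • x').hom.hom.hom P.1, map_mem_torsionPoints ((d : ℤ) • x') P.2⟩ :=
    Subtype.ext (by rw [smul_add]; exact map_hom_add_apply _ _ P.1)
  rw [eP, weilPairingLevel_mul_left, h N P Q, h' N P Q, torsionPoints_map_add, weilPairingLevel_mul_right]

/-- The zero pair: `(0, 0)` is a level adjoint pair of every weight (`ē(1, Q) = 1 = ē(P, 1)`). [cite: Lang1983AbelianVarieties, Ch. VII §2 Prop. 3] -/
theorem levelAdjoint_zero (ΘA : CartierDivisor A.X.left) (ΘB : CartierDivisor B.X.left) (d : ℕ)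
    (N : ℕ) [IsDominant (Hom.toSchemeHom ((N : ℤ) • 𝟙 A))] [IsDominant (Hom.toSchemeHom ((N : ℤ) • 𝟙 B))]
    (P : A.torsionPoints K N) (Q : B.torsionPoints K N) :
    B.weilPairingLevel ΘB ⟨AlgPoints.map ((d : ℤ) • (0 : A ⟶ B)).hom.hom.hom P.1, map_mem_torsionPoints ((d : ℤ) • (0 : A ⟶ B)) P.2⟩ Q =
      A.weilPairingLevel ΘA P ⟨AlgPoints.map (0 : B ⟶ A).hom.hom.hom Q.1, map_mem_torsionPoints (0 : B ⟶ A) Q.2⟩ := by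
  have eP : (⟨AlgPoints.map ((d : ℤ) • (0 : A ⟶ B)).hom.hom.hom P.1, map_mem_torsionPoints ((d : ℤ) • (0 : A ⟶ B)) P.2⟩ :
      B.torsionPoints K N) = 1 := Subtype.ext (by rw [smul_zero]; exact map_hom_zero_apply P.1)
  rw [eP, torsionPoints_map_zero, weilPairingLevel_one_left, weilPairingLevel_one_right]

/-- **Level adjoints of a finite SUM**: `(Σ_j x_j, Σ_j y_j)` from the `(x_j, y_j)`, all of one weight `d`.
[cite: Lang1983AbelianVarieties, Ch. VII §2 Prop. 3] [cite: MumfordAV1970, §20 (p. 186, property (3) of e_n)] -/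
theorem levelAdjoint_sum (ΘA : CartierDivisor A.X.left) (ΘB : CartierDivisor B.X.left) {J : Type*} (s : Finset J)
    {x : J → (A ⟶ B)} {y : J → (B ⟶ A)} {d : ℕ}
    (h : ∀ j ∈ s, ∀ (N : ℕ) [IsDominant (Hom.toSchemeHom ((N : ℤ) • 𝟙 A))] [IsDominant (Hom.toSchemeHom ((N : ℤ) • 𝟙 B))]
      (P : A.torsionPoints K N) (Q : B.torsionPoints K N),
      B.weilPairingLevel ΘB ⟨AlgPoints.map ((d : ℤ) • x j).hom.hom.hom P.1, map_mem_torsionPoints ((d : ℤ) • x j) P.2⟩ Q =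
        A.weilPairingLevel ΘA P ⟨AlgPoints.map (y j).hom.hom.hom Q.1, map_mem_torsionPoints (y j) Q.2⟩)
    (N : ℕ) [IsDominant (Hom.toSchemeHom ((N : ℤ) • 𝟙 A))] [IsDominant (Hom.toSchemeHom ((N : ℤ) • 𝟙 B))]
    (P : A.torsionPoints K N) (Q : B.torsionPoints K N) :
    B.weilPairingLevel ΘB ⟨AlgPoints.map ((d : ℤ) • ∑ j ∈ s, x j).hom.hom.hom P.1, map_mem_torsionPoints ((d : ℤ) • ∑ j ∈ s, x j) P.2⟩ Q =
      A.weilPairingLevel ΘA P ⟨AlgPoints.map (∑ j ∈ s, y j).hom.hom.hom Q.1, map_mem_torsionPoints (∑ j ∈ s, y j) Q.2⟩ := by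
  classical
  induction s using Finset.induction_on with
  | empty =>
    have e0 : (⟨AlgPoints.map ((d : ℤ) • ∑ j ∈ (∅ : Finset J), x j).hom.hom.hom P.1,
        map_mem_torsionPoints ((d : ℤ) • ∑ j ∈ (∅ : Finset J), x j) P.2⟩ : B.torsionPoints K N) = 1 :=
      Subtype.ext (by rw [Finset.sum_empty, smul_zero]; exact map_hom_zero_apply P.1)
    have e0' : (⟨AlgPoints.map (∑ j ∈ (∅ : Finset J), y j).hom.hom.hom Q.1,
        map_mem_torsionPoints (∑ j ∈ (∅ : Finset J), y j) Q.2⟩ : A.torsionPoints K N) = 1 :=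
      Subtype.ext (by rw [Finset.sum_empty]; exact map_hom_zero_apply Q.1)
    rw [e0, e0', weilPairingLevel_one_left, weilPairingLevel_one_right]
  | insert j s hj ih =>
    have eP : (⟨AlgPoints.map ((d : ℤ) • ∑ j ∈ insert j s, x j).hom.hom.hom P.1,
        map_mem_torsionPoints ((d : ℤ) • ∑ j ∈ insert j s, x j) P.2⟩ : B.torsionPoints K N) =
      ⟨AlgPoints.map ((d : ℤ) • x j).hom.hom.hom P.1, map_mem_torsionPoints ((d : ℤ) • x j) P.2⟩ *
        ⟨AlgPoints.map ((d : ℤ) • ∑ j ∈ s, x j).hom.hom.hom P.1, map_mem_torsionPoints ((d : ℤ) • ∑ j ∈ s, x j) P.2⟩ :=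
      Subtype.ext (by rw [Finset.sum_insert hj, smul_add]; exact map_hom_add_apply _ _ P.1)
    have eQ : (⟨AlgPoints.map (∑ j ∈ insert j s, y j).hom.hom.hom Q.1, map_mem_torsionPoints (∑ j ∈ insert j s, y j) Q.2⟩ :
        A.torsionPoints K N) =
      ⟨AlgPoints.map (y j).hom.hom.hom Q.1, map_mem_torsionPoints (y j) Q.2⟩ *
        ⟨AlgPoints.map (∑ j ∈ s, y j).hom.hom.hom Q.1, map_mem_torsionPoints (∑ j ∈ s, y j) Q.2⟩ :=
      Subtype.ext (by rw [Finset.sum_insert hj]; exact map_hom_add_apply _ _ Q.1)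
    rw [eP, eQ, weilPairingLevel_mul_left, weilPairingLevel_mul_right, h j (Finset.mem_insert_self j s) N P Q,
      ih (fun i hi => h i (Finset.mem_insert_of_mem hi))]

/-- **Raise the WEIGHT**: from `(x, y)` of weight `d` to `(x, m·y)` of weight `m·d` (`ē((md·x)P, Q) = ē((d·x)P, Q)^m = ē(P, yQ)^m = ē(P, (m·y)Q)`).
[cite: Lang1983AbelianVarieties, Ch. VII §2 Prop. 3] -/
theorem levelAdjoint_weight_mul (ΘA : CartierDivisor A.X.left) (ΘB : CartierDivisor B.X.left)
    {x : A ⟶ B} {y : B ⟶ A} {d : ℕ}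
    (h : ∀ (N : ℕ) [IsDominant (Hom.toSchemeHom ((N : ℤ) • 𝟙 A))] [IsDominant (Hom.toSchemeHom ((N : ℤ) • 𝟙 B))]
      (P : A.torsionPoints K N) (Q : B.torsionPoints K N),
      B.weilPairingLevel ΘB ⟨AlgPoints.map ((d : ℤ) • x).hom.hom.hom P.1, map_mem_torsionPoints ((d : ℤ) • x) P.2⟩ Q =
        A.weilPairingLevel ΘA P ⟨AlgPoints.map y.hom.hom.hom Q.1, map_mem_torsionPoints y Q.2⟩)
    (m : ℕ) (N : ℕ) [IsDominant (Hom.toSchemeHom ((N : ℤ) • 𝟙 A))] [IsDominant (Hom.toSchemeHom ((N : ℤ) • 𝟙 B))]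
    (P : A.torsionPoints K N) (Q : B.torsionPoints K N) :
    B.weilPairingLevel ΘB ⟨AlgPoints.map (((m * d : ℕ) : ℤ) • x).hom.hom.hom P.1, map_mem_torsionPoints (((m * d : ℕ) : ℤ) • x) P.2⟩ Q =
      A.weilPairingLevel ΘA P ⟨AlgPoints.map ((m : ℤ) • y).hom.hom.hom Q.1, map_mem_torsionPoints ((m : ℤ) • y) Q.2⟩ := by
  have eP : (⟨AlgPoints.map (((m * d : ℕ) : ℤ) • x).hom.hom.hom P.1, map_mem_torsionPoints (((m * d : ℕ) : ℤ) • x) P.2⟩ :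
        B.torsionPoints K N) =
      ⟨AlgPoints.map ((d : ℤ) • x).hom.hom.hom P.1, map_mem_torsionPoints ((d : ℤ) • x) P.2⟩ ^ m :=
    Subtype.ext (by
      rw [show (((m * d : ℕ) : ℤ) • x) = (m : ℤ) • ((d : ℤ) • x) by rw [smul_smul, Nat.cast_mul]]
      exact map_hom_natCast_zsmul_apply m _ P.1)
  rw [eP, weilPairingLevel_pow_left, h N P Q, torsionPoints_map_natCast_zsmul, weilPairingLevel_pow_right]

/-- Multiply BOTH members by `n`: `(n·x, n·y)` has the same weight as `(x, y)`. [cite: Lang1983AbelianVarieties, Ch. VII §2 Prop. 3] -/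
theorem levelAdjoint_nsmul (ΘA : CartierDivisor A.X.left) (ΘB : CartierDivisor B.X.left)
    {x : A ⟶ B} {y : B ⟶ A} {d : ℕ}
    (h : ∀ (N : ℕ) [IsDominant (Hom.toSchemeHom ((N : ℤ) • 𝟙 A))] [IsDominant (Hom.toSchemeHom ((N : ℤ) • 𝟙 B))]
      (P : A.torsionPoints K N) (Q : B.torsionPoints K N),
      B.weilPairingLevel ΘB ⟨AlgPoints.map ((d : ℤ) • x).hom.hom.hom P.1, map_mem_torsionPoints ((d : ℤ) • x) P.2⟩ Q =
        A.weilPairingLevel ΘA P ⟨AlgPoints.map y.hom.hom.hom Q.1, map_mem_torsionPoints y Q.2⟩)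
    (n : ℕ) (N : ℕ) [IsDominant (Hom.toSchemeHom ((N : ℤ) • 𝟙 A))] [IsDominant (Hom.toSchemeHom ((N : ℤ) • 𝟙 B))]
    (P : A.torsionPoints K N) (Q : B.torsionPoints K N) :
    B.weilPairingLevel ΘB ⟨AlgPoints.map ((d : ℤ) • ((n : ℤ) • x)).hom.hom.hom P.1, map_mem_torsionPoints ((d : ℤ) • ((n : ℤ) • x)) P.2⟩ Q =
      A.weilPairingLevel ΘA P ⟨AlgPoints.map ((n : ℤ) • y).hom.hom.hom Q.1, map_mem_torsionPoints ((n : ℤ) • y) Q.2⟩ := by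
  have eP : (⟨AlgPoints.map ((d : ℤ) • ((n : ℤ) • x)).hom.hom.hom P.1, map_mem_torsionPoints ((d : ℤ) • ((n : ℤ) • x)) P.2⟩ :
        B.torsionPoints K N) =
      ⟨AlgPoints.map ((d : ℤ) • x).hom.hom.hom P.1, map_mem_torsionPoints ((d : ℤ) • x) P.2⟩ ^ n :=
    Subtype.ext (by rw [smul_comm]; exact map_hom_natCast_zsmul_apply n _ P.1)
  rw [eP, weilPairingLevel_pow_left, h N P Q, torsionPoints_map_natCast_zsmul, weilPairingLevel_pow_right]

/-- The identity is its own level adjoint (weight `1`). [cite: MumfordAV1970, §20 (p. 186, property (3) of e_n)] -/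
theorem levelAdjoint_id (Θ : CartierDivisor A.X.left) (N : ℕ) [IsDominant (Hom.toSchemeHom ((N : ℤ) • 𝟙 A))]
    (P Q : A.torsionPoints K N) :
    A.weilPairingLevel Θ ⟨AlgPoints.map (((1 : ℕ) : ℤ) • 𝟙 A).hom.hom.hom P.1, map_mem_torsionPoints (((1 : ℕ) : ℤ) • 𝟙 A) P.2⟩ Q =
      A.weilPairingLevel Θ P ⟨AlgPoints.map (𝟙 A : A ⟶ A).hom.hom.hom Q.1, map_mem_torsionPoints (𝟙 A) Q.2⟩ := by
  have eP : (⟨AlgPoints.map (((1 : ℕ) : ℤ) • 𝟙 A).hom.hom.hom P.1, map_mem_torsionPoints (((1 : ℕ) : ℤ) • 𝟙 A) P.2⟩ :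
      A.torsionPoints K N) = P :=
    Subtype.ext (show AlgPoints.map (((1 : ℕ) : ℤ) • 𝟙 A).hom.hom.hom P.1 = P.1 by
      rw [Nat.cast_one, one_smul, AlgPoints.map_apply]; exact Category.comp_id _)
  rw [eP, torsionPoints_map_id]

/-! ## §2 Isomorphisms with compatible divisors -/

/-- **An isomorphism with `Θ_A = φ^*Θ_B` is level-adjoint to its inverse (weight 1)**: `ē^{Θ_B}(φ P, Q) = ē^{φ^*Θ_B}(P, φ⁻¹ Q)`
(★ `weilPairingLevel_pullback` «`ē^{f^*Θ}(P, Q) = ē^Θ(fP, fQ)`» at `(P, φ⁻¹Q)`; the dominance binder on `φ` — needed to FORM `φ^*Θ_B` — holds by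
★ `isDominant_toSchemeHom_of_comp_eq_id φ.hom φ.inv φ.inv_hom_id`).  For a level
structure transported along a translate isomorphism `T_γ : X_N ⥲ X_{γ⁻¹Nγ}` of curves this is the `T_γ`-letter of a push–pull word.
[cite: MumfordAV1970, §20 (p. 186, property (3) of e_n)] -/
theorem levelAdjoint_iso_pullback (φ : A ≅ B) [IsDominant (Hom.toSchemeHom φ.hom)] (ΘB : CartierDivisor B.X.left)
    (N : ℕ) [IsDominant (Hom.toSchemeHom ((N : ℤ) • 𝟙 A))] [IsDominant (Hom.toSchemeHom ((N : ℤ) • 𝟙 B))]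
    (P : A.torsionPoints K N) (Q : B.torsionPoints K N) :
    B.weilPairingLevel ΘB ⟨AlgPoints.map (((1 : ℕ) : ℤ) • φ.hom).hom.hom.hom P.1, map_mem_torsionPoints (((1 : ℕ) : ℤ) • φ.hom) P.2⟩ Q =
      A.weilPairingLevel (ΘB.pullback (Hom.toSchemeHom φ.hom)) P
        ⟨AlgPoints.map φ.inv.hom.hom.hom Q.1, map_mem_torsionPoints φ.inv Q.2⟩ := by
  rw [weilPairingLevel_pullback φ.hom ΘB]
  have eP : (⟨AlgPoints.map (((1 : ℕ) : ℤ) • φ.hom).hom.hom.hom P.1, map_mem_torsionPoints (((1 : ℕ) : ℤ) • φ.hom) P.2⟩ :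
      B.torsionPoints K N) = ⟨AlgPoints.map φ.hom.hom.hom.hom P.1, map_mem_torsionPoints φ.hom P.2⟩ :=
    Subtype.ext (by rw [Nat.cast_one, one_smul])
  have eQ : (⟨AlgPoints.map φ.hom.hom.hom.hom (AlgPoints.map φ.inv.hom.hom.hom Q.1),
        map_mem_torsionPoints φ.hom (map_mem_torsionPoints φ.inv Q.2)⟩ : B.torsionPoints K N) = Q :=
    Subtype.ext (show AlgPoints.map φ.hom.hom.hom.hom (AlgPoints.map φ.inv.hom.hom.hom Q.1) = Q.1 by
      rw [← map_hom_comp_apply, φ.inv_hom_id, AlgPoints.map_apply]; exact Category.comp_id _)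
  rw [eP, eQ]

/-! ## §3 Reversal by skew-symmetry -/

/-- **REVERSAL**: on divisible point groups (every rational point an `N`-th power — e.g. `K` algebraically closed, `N` invertible),
skew-symmetry `ē(Q, P) = ē(P, Q)⁻¹` (★ `weilPairingLevel_swap`) turns the level adjoint pair `(x, y)` of weight `d` for `(Θ_A, Θ_B)` into the
pair `(y, d·x)` of weight `1` for `(Θ_B, Θ_A)`: `ē^{Θ_A}((1·y) Q, P) = ē^{Θ_B}(Q, (d·x) P)`.  With (F-P2) («`p^*` adjoint to `Nm_p`») this yields
the `Nm`-letters from the `p^*`-letters. [cite: Lang1983AbelianVarieties, Ch. VII §2 Thm. 5 (i)] [cite: MumfordAV1970, §20 (p. 186, property (3) of e_n)] -/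
theorem levelAdjoint_reverse (ΘA : CartierDivisor A.X.left) (ΘB : CartierDivisor B.X.left)
    {x : A ⟶ B} {y : B ⟶ A} {d : ℕ}
    (h : ∀ (N : ℕ) [IsDominant (Hom.toSchemeHom ((N : ℤ) • 𝟙 A))] [IsDominant (Hom.toSchemeHom ((N : ℤ) • 𝟙 B))]
      (P : A.torsionPoints K N) (Q : B.torsionPoints K N),
      B.weilPairingLevel ΘB ⟨AlgPoints.map ((d : ℤ) • x).hom.hom.hom P.1, map_mem_torsionPoints ((d : ℤ) • x) P.2⟩ Q =
        A.weilPairingLevel ΘA P ⟨AlgPoints.map y.hom.hom.hom Q.1, map_mem_torsionPoints y Q.2⟩)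
    (N : ℕ) [IsDominant (Hom.toSchemeHom ((N : ℤ) • 𝟙 A))] [IsDominant (Hom.toSchemeHom ((N : ℤ) • 𝟙 B))]
    (hA : Function.Surjective fun R : A.Points K => R ^ N) (hB : Function.Surjective fun R : B.Points K => R ^ N)
    (Q : B.torsionPoints K N) (P : A.torsionPoints K N) :
    A.weilPairingLevel ΘA ⟨AlgPoints.map (((1 : ℕ) : ℤ) • y).hom.hom.hom Q.1, map_mem_torsionPoints (((1 : ℕ) : ℤ) • y) Q.2⟩ P =
      B.weilPairingLevel ΘB Q ⟨AlgPoints.map ((d : ℤ) • x).hom.hom.hom P.1, map_mem_torsionPoints ((d : ℤ) • x) P.2⟩ := by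
  have hdA : ∀ R : A.torsionPoints K N, ∃ S : A.Points K, S ^ N = R.1 := fun R => hA R.1
  have hdB : ∀ R : B.torsionPoints K N, ∃ S : B.Points K, S ^ N = R.1 := fun R => hB R.1
  have e1 : (⟨AlgPoints.map (((1 : ℕ) : ℤ) • y).hom.hom.hom Q.1, map_mem_torsionPoints (((1 : ℕ) : ℤ) • y) Q.2⟩ :
      A.torsionPoints K N) = ⟨AlgPoints.map y.hom.hom.hom Q.1, map_mem_torsionPoints y Q.2⟩ :=
    Subtype.ext (by rw [Nat.cast_one, one_smul])
  rw [e1, A.weilPairingLevel_swap ΘA P _ (hdA P) (hdA _), B.weilPairingLevel_swap ΘB _ Q (hdB _) (hdB Q), h N P Q]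

/-! ## §4 Matrix entries of a biproduct: adjoints for a product pairing transpose the entry -/

/-- **ENTRIES OF A BIPRODUCT (fan presentation)**: let `Y` be presented as a biproduct of abelian varieties `J c` (`c ∈ C` finite) by
projections `π c : Y → J c` and injections `ι c : J c → Y` with `ι c ≫ π c = 𝟙` and `ι c ≫ π c′ = 0` (`c ≠ c′`), and let the divisor `Θ` on `Y`
have the PRODUCT level pairings `ē_N^Θ(P, Q) = ∏_c ē_N^{W c}(π_c P, π_c Q)` (e.g. `Θ = Σ_c π_c^* W_c`, ★ `weilPairingLevel_biprod` / `_add` /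
`_pullback`; Mumford §20: the Riemann form of `L₁ ⊠ L₂` is the orthogonal sum).  If `(f, f†)` is a level adjoint pair of weight `d` for
`(W c, W c′)` (`f : J c → J c′`, `f† : J c′ → J c`), then the MATRIX ENTRY `π c ≫ f ≫ ι c′ : Y → Y` has the level adjoint
`π c′ ≫ f† ≫ ι c` of weight `d` for `(Θ, Θ)` — «the adjoint of a matrix for an orthogonal sum is the transposed matrix of adjoints».
[cite: MumfordAV1970, §20 (p. 186, property (3) of e_n) and §21] [cite: Lang1983AbelianVarieties, Ch. VII §2 Prop. 3] -/
theorem levelAdjoint_fan_entry {C : Type*} [Fintype C] {J : C → AbelianVariety K} {Y : AbelianVariety K}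
    (π : ∀ c, Y ⟶ J c) (ι : ∀ c, J c ⟶ Y) (hιπ : ∀ c, ι c ≫ π c = 𝟙 (J c)) (hιπ' : ∀ c c', c ≠ c' → ι c ≫ π c' = 0)
    (W : ∀ c, CartierDivisor (J c).X.left) (Θ : CartierDivisor Y.X.left)
    (hpair : ∀ (N : ℕ) [IsDominant (Hom.toSchemeHom ((N : ℤ) • 𝟙 Y))] [∀ c, IsDominant (Hom.toSchemeHom ((N : ℤ) • 𝟙 (J c)))]
      (P Q : Y.torsionPoints K N),
      Y.weilPairingLevel Θ P Q =
        ∏ c, (J c).weilPairingLevel (W c) ⟨AlgPoints.map (π c).hom.hom.hom P.1, map_mem_torsionPoints (π c) P.2⟩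
          ⟨AlgPoints.map (π c).hom.hom.hom Q.1, map_mem_torsionPoints (π c) Q.2⟩)
    {c c' : C} {f : J c ⟶ J c'} {fd : J c' ⟶ J c} {d : ℕ}
    (hf : ∀ (N : ℕ) [IsDominant (Hom.toSchemeHom ((N : ℤ) • 𝟙 (J c)))] [IsDominant (Hom.toSchemeHom ((N : ℤ) • 𝟙 (J c')))]
      (P : (J c).torsionPoints K N) (Q : (J c').torsionPoints K N),
      (J c').weilPairingLevel (W c') ⟨AlgPoints.map ((d : ℤ) • f).hom.hom.hom P.1, map_mem_torsionPoints ((d : ℤ) • f) P.2⟩ Q =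
        (J c).weilPairingLevel (W c) P ⟨AlgPoints.map fd.hom.hom.hom Q.1, map_mem_torsionPoints fd Q.2⟩)
    (N : ℕ) [IsDominant (Hom.toSchemeHom ((N : ℤ) • 𝟙 Y))] [∀ c, IsDominant (Hom.toSchemeHom ((N : ℤ) • 𝟙 (J c)))]
    (P Q : Y.torsionPoints K N) :
    Y.weilPairingLevel Θ ⟨AlgPoints.map ((d : ℤ) • (π c ≫ f ≫ ι c')).hom.hom.hom P.1, map_mem_torsionPoints ((d : ℤ) • (π c ≫ f ≫ ι c')) P.2⟩ Q =
      Y.weilPairingLevel Θ P ⟨AlgPoints.map (π c' ≫ fd ≫ ι c).hom.hom.hom Q.1, map_mem_torsionPoints (π c' ≫ fd ≫ ι c) Q.2⟩ := by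
  classical
  rw [hpair, hpair]
  -- left-hand side: only the `c′`-factor survives
  rw [Finset.prod_eq_single c' (fun c'' _ hne => ?_) (fun h => absurd (Finset.mem_univ c') h),
    Finset.prod_eq_single c (fun c'' _ hne => ?_) (fun h => absurd (Finset.mem_univ c) h)]
  · -- the two surviving factors agree by the adjointness of `(f, f†)`
    have eL : (⟨AlgPoints.map (π c').hom.hom.hom (AlgPoints.map ((d : ℤ) • (π c ≫ f ≫ ι c')).hom.hom.hom P.1),
          map_mem_torsionPoints (π c') (map_mem_torsionPoints ((d : ℤ) • (π c ≫ f ≫ ι c')) P.2)⟩ : (J c').torsionPoints K N) =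
        ⟨AlgPoints.map ((d : ℤ) • f).hom.hom.hom (AlgPoints.map (π c).hom.hom.hom P.1),
          map_mem_torsionPoints ((d : ℤ) • f) (map_mem_torsionPoints (π c) P.2)⟩ :=
      Subtype.ext (show AlgPoints.map (π c').hom.hom.hom (AlgPoints.map ((d : ℤ) • (π c ≫ f ≫ ι c')).hom.hom.hom P.1) =
          AlgPoints.map ((d : ℤ) • f).hom.hom.hom (AlgPoints.map (π c).hom.hom.hom P.1) by
        rw [← map_hom_comp_apply, ← map_hom_comp_apply, Preadditive.zsmul_comp, Category.assoc, Category.assoc, hιπ c',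
          Category.comp_id, Preadditive.comp_zsmul])
    have eR : (⟨AlgPoints.map (π c).hom.hom.hom (AlgPoints.map (π c' ≫ fd ≫ ι c).hom.hom.hom Q.1),
          map_mem_torsionPoints (π c) (map_mem_torsionPoints (π c' ≫ fd ≫ ι c) Q.2)⟩ : (J c).torsionPoints K N) =
        ⟨AlgPoints.map fd.hom.hom.hom (AlgPoints.map (π c').hom.hom.hom Q.1),
          map_mem_torsionPoints fd (map_mem_torsionPoints (π c') Q.2)⟩ :=
      Subtype.ext (show AlgPoints.map (π c).hom.hom.hom (AlgPoints.map (π c' ≫ fd ≫ ι c).hom.hom.hom Q.1) =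
          AlgPoints.map fd.hom.hom.hom (AlgPoints.map (π c').hom.hom.hom Q.1) by
        rw [← map_hom_comp_apply, ← map_hom_comp_apply, Category.assoc, Category.assoc, hιπ c, Category.comp_id])
    rw [eL, eR]
    exact hf N ⟨_, map_mem_torsionPoints (π c) P.2⟩ ⟨_, map_mem_torsionPoints (π c') Q.2⟩
  · -- right-hand side, `c″ ≠ c`: the second argument is the unit point
    have e1 : (⟨AlgPoints.map (π c'').hom.hom.hom (AlgPoints.map (π c' ≫ fd ≫ ι c).hom.hom.hom Q.1),
          map_mem_torsionPoints (π c'') (map_mem_torsionPoints (π c' ≫ fd ≫ ι c) Q.2)⟩ : (J c'').torsionPoints K N) = 1 :=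
      Subtype.ext (show AlgPoints.map (π c'').hom.hom.hom (AlgPoints.map (π c' ≫ fd ≫ ι c).hom.hom.hom Q.1) = 1 by
        rw [← map_hom_comp_apply, Category.assoc, Category.assoc, hιπ' c c'' (Ne.symm hne), comp_zero, comp_zero]
        exact map_hom_zero_apply Q.1)
    rw [e1, weilPairingLevel_one_right]
  · -- left-hand side, `c″ ≠ c′`: the first argument is the unit point
    have e1 : (⟨AlgPoints.map (π c'').hom.hom.hom (AlgPoints.map ((d : ℤ) • (π c ≫ f ≫ ι c')).hom.hom.hom P.1),
          map_mem_torsionPoints (π c'') (map_mem_torsionPoints ((d : ℤ) • (π c ≫ f ≫ ι c')) P.2)⟩ : (J c'').torsionPoints K N) = 1 :=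
      Subtype.ext (show AlgPoints.map (π c'').hom.hom.hom (AlgPoints.map ((d : ℤ) • (π c ≫ f ≫ ι c')).hom.hom.hom P.1) = 1 by
        rw [← map_hom_comp_apply, Preadditive.zsmul_comp, Category.assoc, Category.assoc, hιπ' c' c'' (Ne.symm hne), comp_zero,
          comp_zero, smul_zero]
        exact map_hom_zero_apply P.1)
    rw [e1, weilPairingLevel_one_left]

end AbelianVariety

end Literature.AlgebraicGeometry.Motives

end
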